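import Literature.MathematicalPhysics.QuantumLattice.PeierlsChessboardTorusLongRangeOrder
import HarnessLib

/-!
# The volume-uniform Peierls–chessboard bounds for Fröhlich–Lieb's anisotropic quantum models
# (the XYZ real form `-Σ(J₁S¹S¹ + J₂S²S² + S³S³)`, `J₁ = s₁² ≥ 0 ≥ J₂ = -s₂²`)

Topic `MathematicalPhysics/QuantumLattice`. Fröhlich–Lieb's models (3) (the Ising-anisotropic
Heisenberg antiferromagnet `Σ[SᶻSᶻ + α(SˣSˣ + SʸSʸ)]`, after the sublattice rotation (1.4a)) and
(6) (the anisotropic `xy` model) are, in the tree's vocabulary, the real-form nearest-neighbour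
Hamiltonians `xyzRealFieldHamiltonian L n (s₁²) (-s₂²) 0` of Björnberg–Ueltschi (reflection
positive across every pair of planes, `xyzReal_isRPExponent`; the Ising model is `s₁ = s₂ = 0`).
This file discharges the two structural hypotheses of `PeierlsChessboardTorusBound` /
`PeierlsChessboardTorusLongRangeOrder` for this family on the 2-torus `(ℤ/Nbℤ)²`:

* `xyzRealBond_submatrix_comp`, `xyzRealFieldHamiltonian_submatrix_comp`,
  **`xyzRealFieldHamiltonian_submatrix_comp_addRight`** — translation invariance;
* **`xyzReal_twoPoint_le`** — `Re⟨Pₘ⁺Pₙ⁻⟩_β ≤ 4ρ/(1-ρ)²` for every real single-site `0 ≤ P±` with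
  `P⁺ + P⁻ = 1` and every dipole smallness datum `κ` (`ρ = 4·19⁶·κ^{(b-1)/b⁵} < 1`), all
  `m ≠ n`, uniformly in `N`;
* **`xyzReal_sigma_twoPoint_ge`**, `xyzReal_sigma_twoPoint_ge_half` — the long-range-order floor
  `Re⟨σₘσₙ⟩_β ≥ 1 - 16ρ/(1-ρ)²` (`≥ 1/2` once `κ^{(b-1)/b⁵} ≤ 10⁻¹⁰`) for `σ = P⁺ - P⁻`.

The remaining model-specific input is the smallness datum `κ` (FL §III–IV). No named facts; no
sorries.

## References

* J. Fröhlich, E. H. Lieb, Comm. Math. Phys. **60** (1978) 233–267, §I.A models (3), (6), eq.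
  (1.4a), Thm. 1.1, Cor. 1.2, Thm. 2.1, eq. (1.44). [FrohlichLieb1978]
* J. E. Björnberg, D. Ueltschi, *Reflection positivity and infrared bounds for quantum spin
  systems* (2022), Lemma 5.2, eqs. (5.10)–(5.16). [BjornbergUeltschi2022]
-/

noncomputable section

open Matrix Finset NormedSpace
open scoped Kronecker ComplexOrder MatrixOrder BigOperators
open Literature.MathematicalPhysics.QuantumLattice Literature.Probability.LatticeModels
  Literature.Barriers.CriticalPhenomena.NonGibbs

namespace Literature.MathematicalPhysics.QuantumLattice

/-! ### Translation invariance of the XYZ real-form Hamiltonian -/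

section Translation

variable {Λ : Type*} [Fintype Λ] [DecidableEq Λ] (n : ℕ)

/-- Relabelling Björnberg–Ueltschi's bond with field:
`τ_h(x,y) ↦ τ_{h ∘ π⁻¹}(π x, π y)`. [cite: BjornbergUeltschi2022, eq. (5.15)] -/
theorem xyzRealBond_submatrix_comp (π : Λ ≃ Λ) (J₁ J₂ : ℝ) (h : Λ → ℝ) (x y : Λ) :
    (xyzRealBond n J₁ J₂ h x y : Op Λ (n + 1)).submatrix (fun σ => σ ∘ π) (fun σ => σ ∘ π) =
      xyzRealBond n J₁ J₂ (h ∘ π.symm) (π x) (π y) := by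
  simp only [xyzRealBond, submatrix_add, submatrix_sub, submatrix_neg, submatrix_smul, Pi.add_apply,
    Pi.sub_apply, Pi.neg_apply, Pi.smul_apply, spinBond_submatrix_comp, siteSpin_submatrix_comp,
    Matrix.submatrix_one _ (bijective_comp_equiv (q := n + 1) π).injective, Function.comp_apply,
    Equiv.symm_apply_apply]

end Translation

section TranslationTorus

variable {d : ℕ} (L : ℕ) [NeZero L] (n : ℕ)

/-- A graph automorphism of the torus maps edges to edges. [folklore] -/
private theorem pctx_map_mem_edgeFinset (π : TorusSite d L ≃ TorusSite d L)
    (hπ : ∀ x y, (torusGraph d L).Adj (π x) (π y) ↔ (torusGraph d L).Adj x y)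
    {e : Sym2 (TorusSite d L)} (he : e ∈ (torusGraph d L).edgeFinset) :
    Sym2.map π e ∈ (torusGraph d L).edgeFinset := by
  induction e using Sym2.ind with
  | h x y =>
    rw [Sym2.map_mk, SimpleGraph.mem_edgeFinset, SimpleGraph.mem_edgeSet, hπ]
    exact (SimpleGraph.mem_edgeSet _).1 (SimpleGraph.mem_edgeFinset.1 he)

/-- **Covariance of the XYZ real-form Hamiltonian** under a graph automorphism `π` of the torus:
`H(J₁,J₂,h) ∘ (π × π) = H(J₁,J₂,h ∘ π⁻¹)`. [cite: BjornbergUeltschi2022, eq. (5.10)] -/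
theorem xyzRealFieldHamiltonian_submatrix_comp (π : TorusSite d L ≃ TorusSite d L)
    (hπ : ∀ x y, (torusGraph d L).Adj (π x) (π y) ↔ (torusGraph d L).Adj x y) (J₁ J₂ : ℝ)
    (h : TorusSite d L → ℝ) :
    (xyzRealFieldHamiltonian L n J₁ J₂ h).submatrix (fun σ => σ ∘ π) (fun σ => σ ∘ π) =
      xyzRealFieldHamiltonian L n J₁ J₂ (h ∘ π.symm) := by
  have hπ' : ∀ x y, (torusGraph d L).Adj (π.symm x) (π.symm y) ↔ (torusGraph d L).Adj x y :=
    fun x y => by rw [← hπ (π.symm x) (π.symm y), Equiv.apply_symm_apply, Equiv.apply_symm_apply]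
  unfold xyzRealFieldHamiltonian
  rw [submatrix_finset_sum]
  refine Finset.sum_nbij' (Sym2.map π) (Sym2.map π.symm) (fun e he => ?_) (fun e he => ?_)
    (fun e _ => ?_) (fun e _ => ?_) (fun e _ => ?_)
  · exact pctx_map_mem_edgeFinset L π hπ he
  · exact pctx_map_mem_edgeFinset L π.symm hπ' he
  · simp only [Sym2.map_map, Equiv.symm_comp_self, Sym2.map_id', id_eq]
  · simp only [Sym2.map_map, Equiv.self_comp_symm, Sym2.map_id', id_eq]
  · induction e using Sym2.ind with
    | h x y => rw [Sym2.lift_mk, Sym2.map_mk, Sym2.lift_mk, xyzRealBond_submatrix_comp]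

omit [NeZero L] in
/-- Translations are automorphisms of the torus graph. [folklore] -/
private theorem pctx_torusGraph_adj_add_right (v x y : TorusSite d L) :
    (torusGraph d L).Adj (x + v) (y + v) ↔ (torusGraph d L).Adj x y := by
  simp only [torusGraph_adj_iff, add_right_comm _ v, add_left_inj, ne_eq]

/-- **Translation invariance of the XYZ real-form Hamiltonian without field**:
`H(J₁,J₂,0) ∘ (τ_v × τ_v) = H(J₁,J₂,0)`. [cite: BjornbergUeltschi2022, eq. (5.10)] -/
theorem xyzRealFieldHamiltonian_submatrix_comp_addRight (J₁ J₂ : ℝ) (v : TorusSite d L) :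
    (xyzRealFieldHamiltonian L n J₁ J₂ 0).submatrix (fun σ => σ ∘ ⇑(Equiv.addRight v))
        (fun σ => σ ∘ ⇑(Equiv.addRight v)) = xyzRealFieldHamiltonian L n J₁ J₂ 0 := by
  rw [xyzRealFieldHamiltonian_submatrix_comp L n (Equiv.addRight v)
    (fun x y => pctx_torusGraph_adj_add_right L v x y)]
  rfl

end TranslationTorus

/-! ### The bounds for the XYZ real-form models on the 2-torus -/

section Model

variable {N b : ℕ} [NeZero N] [NeZero b] (n : ℕ)

/-- **Volume-uniform Peierls–chessboard two-point bound for `-Σ(s₁²S¹S¹ - s₂²S²S² + S³S³)`**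
(FL models (3), (6) in rotated/real form; every spin, every `β ≥ 0`, `N` even, `N > 1`,
`Nb ≥ 3`): for real single-site `0 ≤ P±` with `P⁺ + P⁻ = 1`, a dipole smallness bound
`Re⟨P_Λ(p)⟩ ≤ κ^{N²}` (`0 < κ ≤ 1`) and `ρ = 4·19⁶·κ^{(b-1)/b⁵} < 1`:
`Re⟨Pₘ⁺Pₙ⁻⟩_β ≤ 4ρ/(1-ρ)²` for all `m ≠ n`, uniformly in `N`.
[cite: FrohlichLieb1978, Thm. 1.1, Cor. 1.2, Thm. 2.1, eq. (1.44)] -/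
theorem xyzReal_twoPoint_le [NeZero (N * b)] (hN : Even N) (hN1 : 1 < N) (hL : 2 < N * b)
    (s₁ s₂ : ℝ) {β : ℝ} (hβ : 0 ≤ β)
    {Pp Pm : Matrix (Fin (n + 1)) (Fin (n + 1)) ℂ} (hPp : Pp.PosSemidef) (hPm : Pm.PosSemidef)
    (hsum : Pp + Pm = 1) (hPpr : Pp.map (starRingEnd ℂ) = Pp) (hPmr : Pm.map (starRingEnd ℂ) = Pm)
    {κ : ℝ} (hκ0 : 0 < κ) (hκ1 : κ ≤ 1)
    (hsmall : ∀ (v i j : TorusSite 2 (N * b)),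
      (∃ k : Fin 2, j = i + Pi.single k 1 ∨ i = j + Pi.single k 1) →
      blockOf N b (i - v) = blockOf N b (j - v) →
      (Matrix.gibbsState β (xyzRealFieldHamiltonian (N * b) n (s₁ ^ 2) (-(s₂ ^ 2)) 0)
        (productOp fun y => cubePattern hN v (selectedOp Pp Pm {i} {j}) (blockOf N b (i - v))
          (mirroredOffset hN y))).re ≤ κ ^ (N ^ 2))
    (hρ : 4 * 19 ^ 6 * κ ^ (((b - 1 : ℕ) : ℝ) / (b : ℝ) ^ (2 * 2 + 1)) < 1)
    {m n' : TorusSite 2 (N * b)} (hmn : m ≠ n') :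
    (Matrix.gibbsState β (xyzRealFieldHamiltonian (N * b) n (s₁ ^ 2) (-(s₂ ^ 2)) 0)
        (onSite m Pp * onSite n' Pm)).re ≤
      4 * (4 * 19 ^ 6 * κ ^ (((b - 1 : ℕ) : ℝ) / (b : ℝ) ^ (2 * 2 + 1))) /
        (1 - 4 * 19 ^ 6 * κ ^ (((b - 1 : ℕ) : ℝ) / (b : ℝ) ^ (2 * 2 + 1))) ^ 2 :=
  peierls_chessboard_twoPoint_le hN hN1 hL
    (xyzRealFieldHamiltonian_isHermitian (N * b) n _ _ 0)
    (fun i k => xyzReal_isRPExponent (N * b) n (hN.mul_right b) s₁ s₂ hβ i (blockPlane N b k))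
    (xyzRealFieldHamiltonian_submatrix_comp_addRight (N * b) n _ _)
    hPp hPm hsum hPpr hPmr hκ0 hκ1 hsmall hρ hmn

/-- **Long-range-order floor for `-Σ(s₁²S¹S¹ - s₂²S²S² + S³S³)`** (two-valued observable
`σ = P⁺ - P⁻`): under the hypotheses of `xyzReal_twoPoint_le`,
`Re⟨σₘσₙ⟩_β ≥ 1 - 16ρ/(1-ρ)²` for all `m ≠ n`, uniformly in `N`.
[cite: FrohlichLieb1978, eqs. (1.11)–(1.24), Thm. 1.1, Cor. 1.2] -/
theorem xyzReal_sigma_twoPoint_ge [NeZero (N * b)] (hN : Even N) (hN1 : 1 < N) (hL : 2 < N * b)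
    (s₁ s₂ : ℝ) {β : ℝ} (hβ : 0 ≤ β)
    {Pp Pm : Matrix (Fin (n + 1)) (Fin (n + 1)) ℂ} (hPp : Pp.PosSemidef) (hPm : Pm.PosSemidef)
    (hsum : Pp + Pm = 1) (hPpr : Pp.map (starRingEnd ℂ) = Pp) (hPmr : Pm.map (starRingEnd ℂ) = Pm)
    {κ : ℝ} (hκ0 : 0 < κ) (hκ1 : κ ≤ 1)
    (hsmall : ∀ (v i j : TorusSite 2 (N * b)),
      (∃ k : Fin 2, j = i + Pi.single k 1 ∨ i = j + Pi.single k 1) →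
      blockOf N b (i - v) = blockOf N b (j - v) →
      (Matrix.gibbsState β (xyzRealFieldHamiltonian (N * b) n (s₁ ^ 2) (-(s₂ ^ 2)) 0)
        (productOp fun y => cubePattern hN v (selectedOp Pp Pm {i} {j}) (blockOf N b (i - v))
          (mirroredOffset hN y))).re ≤ κ ^ (N ^ 2))
    (hρ : 4 * 19 ^ 6 * κ ^ (((b - 1 : ℕ) : ℝ) / (b : ℝ) ^ (2 * 2 + 1)) < 1)
    {m n' : TorusSite 2 (N * b)} (hmn : m ≠ n') :
    1 - 4 * (4 * (4 * 19 ^ 6 * κ ^ (((b - 1 : ℕ) : ℝ) / (b : ℝ) ^ (2 * 2 + 1))) /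
        (1 - 4 * 19 ^ 6 * κ ^ (((b - 1 : ℕ) : ℝ) / (b : ℝ) ^ (2 * 2 + 1))) ^ 2) ≤
      (Matrix.gibbsState β (xyzRealFieldHamiltonian (N * b) n (s₁ ^ 2) (-(s₂ ^ 2)) 0)
        (onSite m (Pp - Pm) * onSite n' (Pp - Pm))).re :=
  peierls_chessboard_sigma_twoPoint_ge hN hN1 hL
    (xyzRealFieldHamiltonian_isHermitian (N * b) n _ _ 0)
    (fun i k => xyzReal_isRPExponent (N * b) n (hN.mul_right b) s₁ s₂ hβ i (blockPlane N b k))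
    (xyzRealFieldHamiltonian_submatrix_comp_addRight (N * b) n _ _)
    hPp hPm hsum hPpr hPmr hκ0 hκ1 hsmall hρ hmn

/-- The quotable threshold for the XYZ real-form models: `κ^{(b-1)/b⁵} ≤ 10⁻¹⁰` gives
`Re⟨σₘσₙ⟩_β ≥ 1/2` for all `m ≠ n`, every volume. [cite: FrohlichLieb1978, Thm. 1.1, Cor. 1.2] -/
theorem xyzReal_sigma_twoPoint_ge_half [NeZero (N * b)] (hN : Even N) (hN1 : 1 < N)
    (hL : 2 < N * b) (s₁ s₂ : ℝ) {β : ℝ} (hβ : 0 ≤ β)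
    {Pp Pm : Matrix (Fin (n + 1)) (Fin (n + 1)) ℂ} (hPp : Pp.PosSemidef) (hPm : Pm.PosSemidef)
    (hsum : Pp + Pm = 1) (hPpr : Pp.map (starRingEnd ℂ) = Pp) (hPmr : Pm.map (starRingEnd ℂ) = Pm)
    {κ : ℝ} (hκ0 : 0 < κ) (hκ1 : κ ≤ 1)
    (hsmall : ∀ (v i j : TorusSite 2 (N * b)),
      (∃ k : Fin 2, j = i + Pi.single k 1 ∨ i = j + Pi.single k 1) →
      blockOf N b (i - v) = blockOf N b (j - v) →
      (Matrix.gibbsState β (xyzRealFieldHamiltonian (N * b) n (s₁ ^ 2) (-(s₂ ^ 2)) 0)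
        (productOp fun y => cubePattern hN v (selectedOp Pp Pm {i} {j}) (blockOf N b (i - v))
          (mirroredOffset hN y))).re ≤ κ ^ (N ^ 2))
    (hθ : κ ^ (((b - 1 : ℕ) : ℝ) / (b : ℝ) ^ (2 * 2 + 1)) ≤ 1 / 10 ^ 10)
    {m n' : TorusSite 2 (N * b)} (hmn : m ≠ n') :
    (1 : ℝ) / 2 ≤ (Matrix.gibbsState β (xyzRealFieldHamiltonian (N * b) n (s₁ ^ 2) (-(s₂ ^ 2)) 0)
        (onSite m (Pp - Pm) * onSite n' (Pp - Pm))).re :=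
  peierls_chessboard_sigma_twoPoint_ge_half hN hN1 hL
    (xyzRealFieldHamiltonian_isHermitian (N * b) n _ _ 0)
    (fun i k => xyzReal_isRPExponent (N * b) n (hN.mul_right b) s₁ s₂ hβ i (blockPlane N b k))
    (xyzRealFieldHamiltonian_submatrix_comp_addRight (N * b) n _ _)
    hPp hPm hsum hPpr hPmr hκ0 hκ1 hsmall hθ hmn

end Model

end Literature.MathematicalPhysics.QuantumLattice

end
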